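/-
Origin: expansion seat `planner-pub-hodgecm-pv10-g4-0`, handover #4 2026-08-18T10:52:09Z (`HOME/pub-hodgecm-pv10-g4/lean/Pv10g4/CongruenceLattice.lean`, md5 bc51ecd5, 324 lines);
landed by the gen-7 packager in gate run 28 as `HodgeCM/PerL34/CongruenceLattice.lean` (stripped 4 #print/#check/#eval lines).
-/
/-
Origin: pub-hodgecm cell, seat pv10-g4 (unit `pub-hodgecm-pv10-g4`, DAG-node prover #10, gen 4), 2026-08-18.
WIP module `Pv10g4.CongruenceLattice`; intended landing place `HodgeCM/PerL34/CongruenceLattice.lean`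
(no import rewrite needed: all imports are tree / Mathlib modules).
-/
import Summits.HodgeConjecture.HodgeCM.PerL34.GodementCompact_2
import Summits.HodgeConjecture.HodgeCM.PerL34.AdelicUnitaryFactorisation
import Summits.HodgeConjecture.HodgeCM.Proofs.LandherrIsotropy

/-!
# Congruence subgroups of an anisotropic unitary group are uniform lattices (PerL v5 ll. 70–73, KERNEL)

PerL v5 ll. 70–73: "… a finite union of quotients `Γ_j\𝔹²` by the congruence subgroups
`Γ_j = G_U(L₀) ∩ g_jK_fg_j⁻¹`; for neat `K_f` these are smooth projective surfaces. A congruence subgroup is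
`Γ = G_U(L₀) ∩ K_f` for some compact open `K_f`; for torsion-free `Γ`, `P^L_Γ := Γ\𝔹²` is a smooth **projective**
surface".  Projectivity needs compactness of `Γ\𝔹² = Γ\G_U(ℝ)/K_∞`, i.e. that the congruence subgroup `Γ` is a
UNIFORM (= discrete and cocompact) lattice in the real group `G_U(ℝ) = U(H)_∞`.  This file proves exactly that, in the kernel, for
every anisotropic `H` and every compact open level `K_f` (conjugates `g_jK_fg_j⁻¹` of a compact open subgroup
are compact open, so all `j` are covered):

* §1 (abstract): for a topological-group isomorphism `Φ : G ≃ₜ* A × B`, a subgroup `Γ₀ ≤ G` and a level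
  `K ≤ B`, the projected subgroup `projLattice Φ Γ₀ K := pr_A (Γ₀ ∩ Φ⁻¹(A × K)) ≤ A` is
  - DISCRETE if `Γ₀` is discrete, `K` is compact (and `G` locally compact Hausdorff, `A` Hausdorff):
    `discreteTopology_projLattice`;
  - COCOMPACT if `G ⧸ Γ₀` is compact and `K` is open: `compactSpace_quotient_projLattice`
    (via `compactSpace_quotient_subgroupOf`: an OPEN subgroup `U` of a group with cocompact `Γ₀` has
    `U ⧸ (Γ₀ ∩ U)` compact — it embeds as the clopen set `π(U) ⊂ G ⧸ Γ₀`).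
* §2 (adelic): with `Φ := splitEquiv L H : U(H)(𝔸_{L⁺}) ≃ₜ* U(H)_∞ × U(H)(𝔸_{L⁺,f})` (pv06-g4, run 26),
  `Γ₀ := U(H)(L⁺)` (discrete: `discreteTopology_adelicUnitaryRat`; cocompact for anisotropic `H`:
  `Godement.compactSpace_adelicUnitaryQuot`, pv10-g3, run 27):
  **`congruenceLattice L H K_f ≤ Uinf L H`** (`≃*` PerL's `G_U(L₀) ∩ (G_U(ℝ) × K_f)`: `congruenceLatticeEquiv`, since
  `γ ↦ γ_∞` is injective on rational points), **`discreteTopology_congruenceLattice`** (`K_f` compact),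
  **`compactSpace_quotient_congruenceLattice`** (`H` anisotropic, `K_f` open), and the `HermSpace3` forms
  under `[L:ℚ] ≠ 2` (landherr-g9's `not_isIsotropic_of_finrank_ne_two`).

Pure kernel mathematics over Mathlib + the package; nothing cited, nothing posited; closures are the standard trio.
-/

set_option autoImplicit false

noncomputable section

open scoped Pointwise MatrixGroups
open NumberField IsDedekindDomain Topology
open Literature.AlgebraicGeometry.ShimuraVarieties
open HodgeCM.Adelic HodgeCM.PerL34.AdelicUnitaryFactorisation

namespace HodgeCM.PerL34.Godement

/-! ## §1 Projected lattices along a product decomposition -/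

section Abstract

variable {G A B : Type*} [Group G] [TopologicalSpace G] [Group A] [TopologicalSpace A]
  [Group B] [TopologicalSpace B]

variable (Φ : G ≃ₜ* A × B)

/-- `pr_A ∘ Φ`. -/
def prA : G →* A := (MonoidHom.fst A B).comp Φ.toMulEquiv.toMonoidHom

/-- `pr_B ∘ Φ`. -/
def prB : G →* B := (MonoidHom.snd A B).comp Φ.toMulEquiv.toMonoidHom

/-- (Ported verbatim from the HodgeCMPerL package; no docstring in the source.) -/
theorem prA_apply (g : G) : prA Φ g = (Φ g).1 := rfl

/-- (Ported verbatim from the HodgeCMPerL package; no docstring in the source.) -/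
theorem prB_apply (g : G) : prB Φ g = (Φ g).2 := rfl

/-- (Ported verbatim from the HodgeCMPerL package; no docstring in the source.) -/
theorem continuous_prA : Continuous (prA Φ) := continuous_fst.comp Φ.continuous

/-- (Ported verbatim from the HodgeCMPerL package; no docstring in the source.) -/
theorem continuous_prB : Continuous (prB Φ) := continuous_snd.comp Φ.continuous

/-- (Ported verbatim from the HodgeCMPerL package; no docstring in the source.) -/
theorem isOpenMap_prA : IsOpenMap (prA Φ) := by
  intro V hV
  have hVeq : prA Φ '' V = Prod.fst '' (Φ.symm ⁻¹' V) := by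
    ext a
    constructor
    · rintro ⟨g, hg, rfl⟩
      exact ⟨Φ g, by rwa [Set.mem_preimage, ContinuousMulEquiv.symm_apply_apply], rfl⟩
    · rintro ⟨p, hp, rfl⟩
      exact ⟨Φ.symm p, hp, by rw [prA_apply, ContinuousMulEquiv.apply_symm_apply]⟩
  rw [hVeq]
  exact isOpenMap_fst _ (hV.preimage Φ.symm.continuous)

variable (Γ₀ : Subgroup G) (K : Subgroup B)

/-- The level subgroup `Φ⁻¹(A × K) ≤ G`. -/
def levelSubgroup : Subgroup G := K.comap (prB Φ)

/-- (Ported verbatim from the HodgeCMPerL package; no docstring in the source.) -/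
theorem mem_levelSubgroup_iff (g : G) : g ∈ levelSubgroup Φ K ↔ (Φ g).2 ∈ K := Iff.rfl

/-- (Ported verbatim from the HodgeCMPerL package; no docstring in the source.) -/
theorem isOpen_levelSubgroup (hK : IsOpen (K : Set B)) : IsOpen (levelSubgroup Φ K : Set G) :=
  hK.preimage (continuous_prB Φ)

/-- **The projected lattice** `pr_A (Γ₀ ∩ Φ⁻¹(A × K)) ≤ A`. -/
def projLattice : Subgroup A := (Γ₀ ⊓ levelSubgroup Φ K).map (prA Φ)

/-- (Ported verbatim from the HodgeCMPerL package; no docstring in the source.) -/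
theorem mem_projLattice_iff (a : A) :
    a ∈ projLattice Φ Γ₀ K ↔ ∃ γ : G, γ ∈ Γ₀ ∧ (Φ γ).2 ∈ K ∧ (Φ γ).1 = a := by
  simp only [projLattice, Subgroup.mem_map, Subgroup.mem_inf, mem_levelSubgroup_iff, prA_apply, and_assoc]

variable [IsTopologicalGroup G]

/-- **An open subgroup of a group with cocompact `Γ` meets `Γ` cocompactly**: `U ⧸ (Γ ∩ U)` is compact.
The natural map `U ⧸ (Γ ∩ U) → G ⧸ Γ` is a continuous open injection with closed (indeed clopen) image
`π(U)`, hence a closed embedding into a compact space. -/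
theorem compactSpace_quotient_subgroupOf (U Γ : Subgroup G) (hU : IsOpen (U : Set G))
    [CompactSpace (G ⧸ Γ)] : CompactSpace (U ⧸ Γ.subgroupOf U) := by
  let j : U ⧸ Γ.subgroupOf U → G ⧸ Γ :=
    Quotient.lift (fun u : U => (QuotientGroup.mk (u : G) : G ⧸ Γ)) (by
      intro a b hab
      have h : ((a : G)⁻¹ * b) ∈ Γ := Subgroup.mem_subgroupOf.mp (QuotientGroup.leftRel_apply.mp hab)
      exact QuotientGroup.eq.mpr h)
  have hj_mk : ∀ u : U, j (QuotientGroup.mk u) = QuotientGroup.mk (u : G) := fun _ => rfl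
  have hjc : Continuous j :=
    Continuous.quotient_lift (QuotientGroup.continuous_mk.comp continuous_subtype_val) _
  have hji : Function.Injective j := by
    intro x y hxy
    obtain ⟨a, rfl⟩ := QuotientGroup.mk_surjective x
    obtain ⟨b, rfl⟩ := QuotientGroup.mk_surjective y
    rw [hj_mk, hj_mk] at hxy
    exact QuotientGroup.eq.mpr (Subgroup.mem_subgroupOf.mpr (QuotientGroup.eq.mp hxy))
  have hjo : IsOpenMap j := by
    intro V hV
    have hVeq : j '' V = ((QuotientGroup.mk : G → G ⧸ Γ) ∘ ((↑) : U → G)) ''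
        ((QuotientGroup.mk : U → U ⧸ Γ.subgroupOf U) ⁻¹' V) := by
      ext x
      constructor
      · rintro ⟨q, hq, rfl⟩
        obtain ⟨u, rfl⟩ := QuotientGroup.mk_surjective q
        exact ⟨u, hq, (hj_mk u).symm⟩
      · rintro ⟨u, hu, rfl⟩
        exact ⟨QuotientGroup.mk u, hu, hj_mk u⟩
    rw [hVeq]
    exact (QuotientGroup.isOpenMap_coe.comp hU.isOpenMap_subtype_val) _
      (hV.preimage QuotientGroup.continuous_mk)
  have hrange : Set.range j = (QuotientGroup.mk : G → G ⧸ Γ) '' (U : Set G) := by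
    ext x
    constructor
    · rintro ⟨q, rfl⟩
      obtain ⟨u, rfl⟩ := QuotientGroup.mk_surjective q
      exact ⟨u, u.2, (hj_mk u).symm⟩
    · rintro ⟨g, hg, rfl⟩
      exact ⟨QuotientGroup.mk ⟨g, hg⟩, hj_mk ⟨g, hg⟩⟩
  -- the image `π(U)` is closed: its preimage `U·Γ` has open complement `⋃_{g ∉ UΓ} U g`
  have hclosed : IsClosed (Set.range j) := by
    rw [hrange, ← (QuotientGroup.isQuotientMap_mk Γ).isClosed_preimage, QuotientGroup.preimage_image_mk,
      ← isOpen_compl_iff, isOpen_iff_forall_mem_open]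
    intro g hg
    refine ⟨(U : Set G) * {g}, ?_, hU.mul_right, ⟨1, U.one_mem, g, Set.mem_singleton g, one_mul g⟩⟩
    rintro _ ⟨u, hu, y, hy, rfl⟩ hmem
    rw [Set.mem_singleton_iff.mp hy] at hmem
    apply hg
    obtain ⟨γ, hγ⟩ := Set.mem_iUnion.mp hmem
    refine Set.mem_iUnion.mpr ⟨γ, ?_⟩
    simp only [Set.mem_preimage, SetLike.mem_coe] at hγ ⊢
    have h := U.mul_mem (U.inv_mem hu) hγ
    simpa only [mul_assoc, inv_mul_cancel_left] using h
  have hemb : IsClosedEmbedding j :=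
    ⟨(IsOpenEmbedding.of_continuous_injective_isOpenMap hjc hji hjo).isEmbedding, hclosed⟩
  exact hemb.compactSpace

/-- **Cocompactness.** If `G ⧸ Γ₀` is compact and the level `K` is open, `A ⧸ pr_A(Γ₀ ∩ Φ⁻¹(A × K))` is
compact: it is a continuous image of the compact `U ⧸ (Γ₀ ∩ U)`, `U = Φ⁻¹(A × K)`. -/
theorem compactSpace_quotient_projLattice (hK : IsOpen (K : Set B)) [CompactSpace (G ⧸ Γ₀)] :
    CompactSpace (A ⧸ projLattice Φ Γ₀ K) := by
  haveI := compactSpace_quotient_subgroupOf (levelSubgroup Φ K) Γ₀ (isOpen_levelSubgroup Φ K hK)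
  let k : levelSubgroup Φ K ⧸ Γ₀.subgroupOf (levelSubgroup Φ K) → A ⧸ projLattice Φ Γ₀ K :=
    Quotient.lift (fun u : levelSubgroup Φ K => (QuotientGroup.mk (prA Φ u) : A ⧸ projLattice Φ Γ₀ K)) (by
      intro a b hab
      have h : ((a : G)⁻¹ * b) ∈ Γ₀ := Subgroup.mem_subgroupOf.mp (QuotientGroup.leftRel_apply.mp hab)
      apply QuotientGroup.eq.mpr
      rw [← map_inv, ← map_mul]
      exact Subgroup.mem_map_of_mem (prA Φ) (Subgroup.mem_inf.mpr ⟨h, (a⁻¹ * b).2⟩))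
  have hkc : Continuous k :=
    Continuous.quotient_lift
      (QuotientGroup.continuous_mk.comp ((continuous_prA Φ).comp continuous_subtype_val)) _
  have hks : Function.Surjective k := by
    intro q
    obtain ⟨a, rfl⟩ := QuotientGroup.mk_surjective q
    have hmem : Φ.symm (a, 1) ∈ levelSubgroup Φ K := by
      rw [mem_levelSubgroup_iff, ContinuousMulEquiv.apply_symm_apply]
      exact K.one_mem
    refine ⟨QuotientGroup.mk ⟨Φ.symm (a, 1), hmem⟩, ?_⟩
    show (QuotientGroup.mk (prA Φ (Φ.symm (a, 1))) : A ⧸ projLattice Φ Γ₀ K) = QuotientGroup.mk a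
    rw [prA_apply, ContinuousMulEquiv.apply_symm_apply]
  rw [← isCompact_univ_iff, ← hks.range_eq]
  exact isCompact_range hkc

variable [IsTopologicalGroup A]

/-- **Discreteness.** If `Γ₀` is discrete and the level `K` is compact, `pr_A(Γ₀ ∩ Φ⁻¹(A × K))` is a
discrete subgroup of `A`: a compact neighbourhood `C` of `1 ∈ G` gives the neighbourhood `pr_A(C)` of
`1 ∈ A`, which meets the projected lattice only in `pr_A` of the finite set `Γ₀ ∩ Φ⁻¹(pr_A(C) × K)`. -/
theorem discreteTopology_projLattice [LocallyCompactSpace G] [T2Space G] [T2Space A]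
    [DiscreteTopology Γ₀] (hK : IsCompact (K : Set B)) :
    DiscreteTopology (projLattice Φ Γ₀ K) := by
  obtain ⟨C, hC, hC1⟩ := exists_compact_mem_nhds (1 : G)
  -- the compact set `D = Φ⁻¹(pr_A(C) × K)` meets the discrete closed `Γ₀` in a finite set
  have hD : IsCompact (Φ.symm '' ((prA Φ '' C) ×ˢ (K : Set B))) :=
    ((hC.image (continuous_prA Φ)).prod hK).image Φ.symm.continuous
  have hfin : ((Γ₀ : Set G) ∩ Φ.symm '' ((prA Φ '' C) ×ˢ (K : Set B))).Finite := by
    refine (hD.inter_left Subgroup.isClosed_of_discrete).finite ?_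
    exact isDiscrete_iff_discreteTopology.mpr
      (DiscreteTopology.of_subset ‹DiscreteTopology Γ₀› Set.inter_subset_left)
  have hF : ((projLattice Φ Γ₀ K : Set A) ∩ prA Φ '' C).Finite := by
    refine (hfin.image (prA Φ)).subset ?_
    rintro a ⟨haΛ, haC⟩
    obtain ⟨γ, hγ, hγK, rfl⟩ := (mem_projLattice_iff Φ Γ₀ K a).mp haΛ
    exact ⟨γ, ⟨hγ, (Φ γ), Set.mk_mem_prod haC hγK, Φ.symm_apply_apply γ⟩, rfl⟩
  rw [discreteTopology_iff_isOpen_singleton_one]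
  have hO : IsOpen (prA Φ '' interior C) := isOpenMap_prA Φ _ isOpen_interior
  have hV : IsOpen (prA Φ '' interior C \ (((projLattice Φ Γ₀ K : Set A) ∩ prA Φ '' C) \ {1})) :=
    hO.sdiff (hF.subset Set.sdiff_subset).isClosed
  have key : ((↑) : projLattice Φ Γ₀ K → A) ⁻¹'
      (prA Φ '' interior C \ (((projLattice Φ Γ₀ K : Set A) ∩ prA Φ '' C) \ {1})) = {1} := by
    ext x
    simp only [Set.mem_preimage, Set.mem_sdiff, Set.mem_singleton_iff, Set.mem_inter_iff, SetLike.mem_coe]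
    constructor
    · rintro ⟨hxO, hxn⟩
      have hxC : (x : A) ∈ prA Φ '' C := Set.image_mono interior_subset hxO
      by_contra hne
      exact hxn ⟨⟨x.2, hxC⟩, fun h => hne (Subtype.ext h)⟩
    · rintro rfl
      refine ⟨⟨1, mem_interior_iff_mem_nhds.mpr hC1, map_one _⟩, ?_⟩
      rintro ⟨-, h1⟩
      exact h1 rfl
  rw [← key]
  exact hV.preimage continuous_subtype_val

end Abstract

/-! ## §2 Congruence subgroups of `U(H)_∞` -/

section Adelic

variable (L : CMField) {n : Type} [Fintype n] [DecidableEq n] (H : Matrix n n L)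

/-- **The congruence subgroup of level `K_f`**, viewed in the real group:
`Γ_H(K_f) := pr_∞ (U(H)(L⁺) ∩ (U(H)_∞ × K_f)) ≤ U(H)_∞ = Uinf L H` (PerL's `Γ = G_U(L₀) ∩ K_f`). -/
def congruenceLattice (Kf : Subgroup (Ufin L H)) : Subgroup (Uinf L H) :=
  projLattice (splitEquiv L H) (adelicUnitaryRat L H) Kf

/-- (Ported verbatim from the HodgeCMPerL package; no docstring in the source.) -/
theorem mem_congruenceLattice_iff (Kf : Subgroup (Ufin L H)) (a : Uinf L H) :
    a ∈ congruenceLattice L H Kf ↔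
      ∃ γ : adelicUnitaryGroup L H, γ ∈ adelicUnitaryRat L H ∧ (splitEquiv L H γ).2 ∈ Kf ∧
        (splitEquiv L H γ).1 = a :=
  mem_projLattice_iff _ _ _ a

/-- `γ ↦ γ_∞` is injective on the rational points `U(H)(L⁺)` (because `L → L_∞ = L ⊗ ℝ` is injective). -/
theorem injOn_splitEquiv_fst_adelicUnitaryRat :
    Set.InjOn (fun γ : adelicUnitaryGroup L H => (splitEquiv L H γ).1) (adelicUnitaryRat L H) := by
  intro γ hγ γ' hγ' h
  obtain ⟨g, -, hg⟩ := (mem_adelicUnitaryRat_iff L H γ).1 hγ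
  obtain ⟨g', -, hg'⟩ := (mem_adelicUnitaryRat_iff L H γ').1 hγ'
  have hinj : Function.Injective (fun x : L => (algebraMap (L : Type) (AdeleRing (𝓞 L) L) x).1) :=
    fun x y hxy => (algebraMap (L : Type) (InfiniteAdeleRing L)).injective hxy
  have hmat := congrArg
    (fun u : Uinf L H => ((u : GL n (InfiniteAdeleRing L)) : Matrix n n (InfiniteAdeleRing L))) h
  simp only [val_splitEquiv_fst] at hmat
  rw [← hg, ← hg', val_toAdeleGL, val_toAdeleGL, Matrix.map_map, Matrix.map_map] at hmat
  have hgg' : g = g' := Units.ext (Matrix.map_injective hinj hmat)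
  apply Subtype.ext
  rw [← hg, ← hg', hgg']

/-- **`Γ_H(K_f) ≅ U(H)(L⁺) ∩ (U(H)_∞ × K_f)`** as groups: the projection `pr_∞` is injective on rational points,
so PerL's `Γ = G_U(L₀) ∩ K_f` and its image in `G_U(ℝ)` are the same group. -/
def congruenceLatticeEquiv (Kf : Subgroup (Ufin L H)) :
    (adelicUnitaryRat L H ⊓ levelSubgroup (splitEquiv L H) Kf : Subgroup (adelicUnitaryGroup L H)) ≃*
      congruenceLattice L H Kf :=
  (MonoidHom.ofInjective (f := (prA (splitEquiv L H)).restrict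
      (adelicUnitaryRat L H ⊓ levelSubgroup (splitEquiv L H) Kf)) (by
        rintro ⟨x, hx⟩ ⟨y, hy⟩ hxy
        exact Subtype.ext (injOn_splitEquiv_fst_adelicUnitaryRat L H (Subgroup.mem_inf.mp hx).1
          (Subgroup.mem_inf.mp hy).1 hxy))).trans
    (MulEquiv.subgroupCongr (MonoidHom.restrict_range _ _))

/-- (Ported verbatim from the HodgeCMPerL package; no docstring in the source.) -/
@[simp] theorem coe_congruenceLatticeEquiv_apply (Kf : Subgroup (Ufin L H))
    (γ : (adelicUnitaryRat L H ⊓ levelSubgroup (splitEquiv L H) Kf : Subgroup (adelicUnitaryGroup L H))) :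
    ((congruenceLatticeEquiv L H Kf γ : congruenceLattice L H Kf) : Uinf L H) =
      (splitEquiv L H (γ : adelicUnitaryGroup L H)).1 := rfl

/-- **`Γ_H(K_f)` is discrete in `U(H)_∞`** for every compact level `K_f` (any `H`). -/
theorem discreteTopology_congruenceLattice (Kf : Subgroup (Ufin L H)) (hKc : IsCompact (Kf : Set (Ufin L H))) :
    DiscreteTopology (congruenceLattice L H Kf) :=
  discreteTopology_projLattice (splitEquiv L H) (adelicUnitaryRat L H) Kf hKc

/-- **`Γ_H(K_f)` is cocompact in `U(H)_∞`** for every open level `K_f`, when `H` is anisotropic. -/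
theorem compactSpace_quotient_congruenceLattice {m : ℕ} (H : Matrix (Fin m) (Fin m) L) (ha : IsAnisotropic L H)
    (Kf : Subgroup (Ufin L H)) (hKo : IsOpen (Kf : Set (Ufin L H))) :
    CompactSpace (Uinf L H ⧸ congruenceLattice L H Kf) := by
  haveI : CompactSpace (adelicUnitaryGroup L H ⧸ adelicUnitaryRat L H) :=
    compactSpace_adelicUnitaryQuot L H ha
  exact compactSpace_quotient_projLattice (splitEquiv L H) (adelicUnitaryRat L H) Kf hKo

/-- **PerL v5 ll. 70–73 (KERNEL): the congruence subgroups of `G_U` are uniform lattices in `G_U(ℝ)`.**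
For `V : HermSpace3 L ι₁` over a CM field with `[L:ℚ] ≠ 2` and a compact open level `K_f ≤ G_U(𝔸_{L₀,f})`,
`Γ = pr_∞(G_U(L₀) ∩ (G_U(ℝ) × K_f))` is discrete and cocompact in `G_U(ℝ) = Uinf L V.Hm`
(so `Γ\𝔹² = Γ\G_U(ℝ)/K_∞` is compact). -/
theorem _root_.HodgeCM.HermSpace3.discreteTopology_congruenceLattice {ι₁ : L →+* ℂ} (V : HermSpace3 L ι₁)
    (Kf : Subgroup (Ufin L V.Hm)) (hKc : IsCompact (Kf : Set (Ufin L V.Hm))) :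
    DiscreteTopology (congruenceLattice L V.Hm Kf) :=
  HodgeCM.PerL34.Godement.discreteTopology_congruenceLattice L V.Hm Kf hKc

/-- (Ported verbatim from the HodgeCMPerL package; no docstring in the source.) -/
theorem _root_.HodgeCM.HermSpace3.compactSpace_quotient_congruenceLattice {ι₁ : L →+* ℂ}
    (V : HermSpace3 L ι₁) (hL : Module.finrank ℚ L ≠ 2)
    (Kf : Subgroup (Ufin L V.Hm)) (hKo : IsOpen (Kf : Set (Ufin L V.Hm))) :
    CompactSpace (Uinf L V.Hm ⧸ congruenceLattice L V.Hm Kf) :=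
  HodgeCM.PerL34.Godement.compactSpace_quotient_congruenceLattice L V.Hm
    (fun x hx => by
      by_contra hne
      exact HermSpace3.not_isIsotropic_of_finrank_ne_two V hL ⟨x, hne, hx⟩)
    Kf hKo

end Adelic

end HodgeCM.PerL34.Godement

end

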